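import Summits.BirchSwinnertonDyer.BirchSwinnertonDyer.Theses.BiquadraticEisensteinDescent
import Summits.BirchSwinnertonDyer.Rank1Residual.WAll.Target
import Summits.BirchSwinnertonDyer.Rank1Residual.X11b.HalvesReceptacle
import Summits.BirchSwinnertonDyer.Rank1Residual.X12.InertCoreManinFree
import Summits.BirchSwinnertonDyer.Rank1Residual.X12.InertCoreEveryCurve
import Summits.BirchSwinnertonDyer.Rank1Residual.X12.InertBadOddPrimeStepL
import Summits.BirchSwinnertonDyer.Rank1Residual.X12.InertCoreUpperHalfTam
import Summits.BirchSwinnertonDyer.Rank1Residual.X12.CMIsogenyInvariance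
import Summits.BirchSwinnertonDyer.Rank1Residual.Partition.MainConjecturesAnticyclotomicGood
import Literature.NumberTheory.EllipticCurves.BDPAnticyclotomicPAdicLFunction
import Literature.NumberTheory.EllipticCurves.Rank1Residual.Typed.X12
import HarnessLib

/-!
# Birth skeleton (BC3) for crux `ManinDatumSupercuspidalCMInert` of route `BiquadraticEisensteinDescent`

Registered stubs `stub_*` (sorried, each a genuine lemma of the line) and the kernel-checked
composition `ManinDatumSupercuspidalCMInert_of : ManinDatumSupercuspidalCMInert` (uses the sorried stubs by name) concluding the ROUTE DECL by name.
Planner seat bsd-wall-cm g0 (typed) / g2 (registered shape: stubs inline, composition uses the stubs by name), 2026-08-27. Probes `Stub → ManinDatumSupercuspidalCMInert` / `Stub → WAllCornerFInertBad`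
all FAIL (folder bc/ManinDatumSupercuspidalCMInert_birth.lean, lean check log in NOTES.md ## birth-certificate).
-/

noncomputable section

open scoped Classical

open WeierstrassCurve NumberField IsDedekindDomain Field PowerSeries
  Literature.NumberTheory.EllipticCurves Literature.NumberTheory.EllipticCurves.ModularForms
  Literature.NumberTheory.EllipticCurves.Rank1Residual
  Literature.NumberTheory.GaloisRepresentations
  Summit.BirchSwinnertonDyer.Rank1Residual Summit.BirchSwinnertonDyer.Rank1Residual.X11b
  Summit.BirchSwinnertonDyer.Rank1Residual.X11b.AcSelmer
  Summit.BirchSwinnertonDyer.Rank1Residual.X11b.Halves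
  Summit.BirchSwinnertonDyer.Rank1Residual.X11b.CongruenceLimit

namespace Summit.BirchSwinnertonDyer.BirchSwinnertonDyer.Cruxes.ManinDatumSupercuspidalCMInert.Birth

open Summit.BirchSwinnertonDyer.BirchSwinnertonDyer.Theses.BiquadraticEisensteinDescent


/-- STUB S5 (M — the SEXTIC cells: a CM curve with j = 0 (CM by ℤ[ζ₃]), analytic rank 1, 5 ∣ N
(Kodaira type II/IV/IV*/II* at 5, tame order e ∈ {3,6}, conductor exponent 2), lattice-optimal
X₀(N)-datum D: 5 ∤ c(D). Edixhoven's bound allows 5 here; the attack is the Néron-model comparison for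
the sextic twist family y² = x³ + k (all such W), where the optimal curve and the twisting are explicit
(Stevens' conjecture c = 1 for the X₁-optimal curve is known in many CM families). 268 of the 995 attacked
pairs (CORE 21/72). -/
theorem stub_S5 :
  ∀ (W : WeierstrassCurve ℚ) [W.IsElliptic] [W.IsGloballyMinimal] [NeZero (W.conductorNorm ℤ)]
    (p : ℕ) [Fact p.Prime] (D : ModularParametrizationData W (W.conductorNorm ℤ))
    (v : IsDedekindDomain.HeightOneSpectrum ℤ),
    Rat.HeightOneSpectrum.natGenerator v = p → W.HasCM → W.analyticRank = 1 → p = 5 → W.j = 0 →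
    CMInert W p → ¬ Good W p →
    (∀ z ∈ D.L.lattice, ∃ w ∈ periodLattice D.f, z = D.c * w) →
    (W.kodairaSymbolAt v = .II ∨ W.kodairaSymbolAt v = .IV ∨ W.kodairaSymbolAt v = .IVstar ∨
      W.kodairaSymbolAt v = .IIstar) → ¬ (p : ℤ) ∣ D.c := by
  sorry

/-- STUB S7 (M — the QUARTIC cells: j = 1728 (CM by ℤ[i]), analytic rank 1, 7 ∣ N (type III/III* at
7, e = 4), lattice-optimal D: 7 ∤ c(D); the quartic twist family y² = x³ + kx. 48 of the 995 pairs
(CORE 6/72). -/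
theorem stub_S7 :
  ∀ (W : WeierstrassCurve ℚ) [W.IsElliptic] [W.IsGloballyMinimal] [NeZero (W.conductorNorm ℤ)]
    (p : ℕ) [Fact p.Prime] (D : ModularParametrizationData W (W.conductorNorm ℤ))
    (v : IsDedekindDomain.HeightOneSpectrum ℤ),
    Rat.HeightOneSpectrum.natGenerator v = p → W.HasCM → W.analyticRank = 1 → p = 7 → W.j = 1728 →
    CMInert W p → ¬ Good W p →
    (∀ z ∈ D.L.lattice, ∃ w ∈ periodLattice D.f, z = D.c * w) →
    (W.kodairaSymbolAt v = .III ∨ W.kodairaSymbolAt v = .IIIstar) → ¬ (p : ℤ) ∣ D.c := by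
  sorry

/-- COMPOSITION (kernel-checked, no sorry outside the stubs): the supercuspidal Manin residual from
stub_S5 (j = 0 cells at 5) and stub_S7 (j = 1728 cells at 7) BY NAME. -/
theorem ManinDatumSupercuspidalCMInert_of : ManinDatumSupercuspidalCMInert := by
  intro W _ _ _ p _ D v hv hCM hr h57 hin hbad hlat hcells
  rcases hcells with ⟨h5, hj, hk⟩ | ⟨h7, hj, hk⟩
  · exact stub_S5 W p D v hv hCM hr h5 hj hin hbad hlat hk
  · exact stub_S7 W p D v hv hCM hr h7 hj hin hbad hlat hk


end Summit.BirchSwinnertonDyer.BirchSwinnertonDyer.Cruxes.ManinDatumSupercuspidalCMInert.Birth
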